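import Summits.QuantumFields.YangMills.Theses.DirichletWindow
import Summits.QuantumFields.YangMills.Theorems.DirichletWindowLocalGaussianityExpMoment
import Literature.MathematicalPhysics.QuantumFieldTheory.WilsonEnergyConvexity
import Literature.MathematicalPhysics.QuantumFieldTheory.LatticeGaugeProofs
import HarnessLib

/-!
# `DirichletWindow.SparsityOfChessboard` (item stmt-QuantumFields-20209)

Route `DirichletWindow` of `QuantumFields/YangMills`, support item
`Summit.QuantumFields.YangMills.Theses.DirichletWindow.SparsityOfChessboard :=
AllSidesCouplingChessboard → CouplingReductionCost → LargeFieldSparsityAllTori` — the analytic glue of the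
large-field-sparsity support line: the coupling-field chessboard on tori of every side (K1, item 20194) and the
coupling-reduction cost (K2, item 20195, a tree theorem `couplingReductionCost_proof`) give, for every `t ∈ (0,1)`,
constants `C`, `β_t` such that for `β ≥ β_t`, EVERY infinite-volume torus-limit state `μ` (limits along tori of any
sides, odd included), every finite set `Z` of plaquettes of `ℤ⁴` and every `η`:
`E_μ exp(tβ ∑_{p∈Z} E_p) ≤ exp(C |Z|)` and `μ(E_p ≥ η ∀ p ∈ Z) ≤ exp(−|Z|(tβη − C))`, `E_p = N − Re tr r(U_p)`.

Proof (genuine; the two hypotheses are used): on the torus of side `M = L + 1` (large),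
`⟨exp(tβ ∑_{q∈Z'} φ_q)⟩_{M,β} = Z_M(κ)/Z_M(β)` for the two-valued coupling field `κ = β` off `Z'`, `(1−t)β` on
`Z'` (`Z'` = image of `Z`, injective for large `M`; `withDensity` algebra `expObs_mul_weight_eq`,
`integral_expCouplingField_const`); K1 (`κm = (1−t)β`) gives `Z(κ)/Z(β) ≤ (Z((1−t)β)/Z(β))^{|Z'|/M⁴}`, K2 gives
`log Z((1−t)β) − log Z(β) ≤ C M⁴`, hence the torus bound `exp(C |Z|)` (`wilsonExpectation_expObs_le_of_chessboard`);
the observable is a bounded continuous cylinder function (`expSum_cylinder`), so the bound passes to every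
`μ ∈ infiniteVolumeLimitPoints` along its defining sequence (`ExpMoment.integral_le_of_mem_limitPoints`); the
probability clause is Markov's inequality in `μ` (with `β_t ≥ 1` so that `tβ > 0`, and `C ≥ 0` w.l.o.g.).
References: Fröhlich–Israel–Lieb–Simon, CMP 62 (1978) (chessboard estimates); Fröhlich–Lieb, CMP 60 (1978)
(exponential-moment ⇒ Peierls bounds); S. Chatterjee, arXiv:1602.01222 (free energy).  With this file the sparsity
line is closed modulo K1 alone (`LargeFieldSparsityAllTori = K1 ∘ K2 ∘ glue`, K2 proved); its original consumer
`PlaquetteVarianceUpper` (8939) is meanwhile proved directly.  RECORD currency; no mass gap, no continuum limit, the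
Yang–Mills problem is NOT advanced by this file.
-/

set_option autoImplicit false

noncomputable section

open MeasureTheory Filter Topology
open Literature.MathematicalPhysics.QuantumFieldTheory Literature.MathematicalPhysics.QuantumLattice

namespace Summit.QuantumFields.YangMills.Theorems

namespace SparsityOfChessboard

/-! ### Finite volume: coupling-field partition functions -/

section Torus

variable {d M N : ℕ} [NeZero M]
variable {G : Type*} [Group G] [TopologicalSpace G] [IsTopologicalGroup G] [CompactSpace G]
  [MeasurableSpace G] [BorelSpace G]
variable (ρ : G →* Matrix (Fin N) (Fin N) ℂ)

omit [CompactSpace G] in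
/-- The integrand `exp(−∑_p c_p φ_p)` of a coupling-field partition function is measurable. [folklore] -/
theorem measurable_expCouplingField (hρ : Continuous ρ) (c : Plaquette d M → ℝ) :
    Measurable fun U : GaugeConfig d M G =>
      Real.exp (-∑ p, c p * ((N : ℝ) - (ρ (plaquetteHolonomy U p.1 p.2.1.1 p.2.1.2)).trace.re)) := by
  refine Real.measurable_exp.comp (Finset.measurable_sum _ fun p _ => ?_).neg
  exact (SoloBlind.measurable_plaquetteCost ρ hρ p).const_mul _

/-- The coupling-field partition function `∫⁻ exp(−∑_p c_p φ_p) dHaar` (K1's `Zκ c`), read as a real number, is the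
Bochner integral `∫ exp(−∑_p c_p φ_p) dHaar`. [folklore] -/
theorem toReal_lintegral_expCouplingField (hρ : Continuous ρ) (c : Plaquette d M → ℝ) :
    (∫⁻ U, ENNReal.ofReal (Real.exp (-∑ p, c p *
        ((N : ℝ) - (ρ (plaquetteHolonomy U p.1 p.2.1.1 p.2.1.2)).trace.re)))
        ∂(Measure.pi fun _ : Edge d M => haarProbability G)).toReal =
      ∫ U, Real.exp (-∑ p, c p * ((N : ℝ) - (ρ (plaquetteHolonomy U p.1 p.2.1.1 p.2.1.2)).trace.re))
        ∂(Measure.pi fun _ : Edge d M => haarProbability G) := by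
  rw [integral_eq_lintegral_of_nonneg_ae (ae_of_all _ fun U => (Real.exp_pos _).le)
    (measurable_expCouplingField ρ hρ c).aestronglyMeasurable]

omit [TopologicalSpace G] [IsTopologicalGroup G] [CompactSpace G] [MeasurableSpace G] [BorelSpace G] in
/-- A CONSTANT coupling field `c ≡ b` gives the Wilson weight: `exp(−∑_p b φ_p) = exp(−b S)`. [folklore] -/
theorem expCouplingField_const (b : ℝ) (U : GaugeConfig d M G) :
    Real.exp (-∑ p : Plaquette d M, b * ((N : ℝ) - (ρ (plaquetteHolonomy U p.1 p.2.1.1 p.2.1.2)).trace.re)) =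
      Real.exp (-b * wilsonAction ρ U) := by
  congr 1
  rw [SoloBlind.wilsonAction_eq_sum_plaquetteCost, neg_mul, Finset.mul_sum]
  rfl

/-- The constant-field partition function is `exp(log Z_M(b))`. [folklore] -/
theorem integral_expCouplingField_const (hρ : Continuous ρ) (b : ℝ) :
    ∫ U, Real.exp (-∑ p : Plaquette d M, b *
        ((N : ℝ) - (ρ (plaquetteHolonomy U p.1 p.2.1.1 p.2.1.2)).trace.re))
        ∂(Measure.pi fun _ : Edge d M => haarProbability G) =
      Real.exp (torusLogPartition d ρ b M) := by
  simp_rw [expCouplingField_const]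
  rw [torusLogPartition_eq_log_integral ρ hρ, Real.exp_log (integral_exp_neg_mul_wilsonAction_pos ρ hρ b)]

omit [TopologicalSpace G] [IsTopologicalGroup G] [CompactSpace G] [MeasurableSpace G] [BorelSpace G] in
/-- The TWO-VALUED coupling field `κ = β − tβ·1_{Z'}` gives the exponential observable against the Wilson weight:
`exp(tβ ∑_{q∈Z'} φ_q) · exp(−β S) = exp(−∑_p κ_p φ_p)`. [folklore] -/
theorem expObs_mul_weight_eq (β t : ℝ) (Z' : Finset (Plaquette d M)) (U : GaugeConfig d M G) :
    SoloBlind.expObs ρ (t * β) Z' U * Real.exp (-β * wilsonAction ρ U) =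
      Real.exp (-∑ p : Plaquette d M, (β - if p ∈ Z' then t * β else 0) *
        ((N : ℝ) - (ρ (plaquetteHolonomy U p.1 p.2.1.1 p.2.1.2)).trace.re)) := by
  classical
  rw [SoloBlind.expObs, ← Real.exp_add]
  congr 1
  have hsum : ∑ p : Plaquette d M, (β - if p ∈ Z' then t * β else 0) *
      ((N : ℝ) - (ρ (plaquetteHolonomy U p.1 p.2.1.1 p.2.1.2)).trace.re) =
      β * wilsonAction ρ U - t * β * ∑ q ∈ Z', SoloBlind.plaquetteCost ρ q.1 q.2.1.1 q.2.1.2 U := by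
    rw [SoloBlind.wilsonAction_eq_sum_plaquetteCost, Finset.mul_sum, Finset.mul_sum]
    simp only [sub_mul, Finset.sum_sub_distrib, ite_mul, zero_mul, Finset.sum_ite_mem,
      Finset.univ_inter]
    rfl
  rw [hsum]
  ring

/-- **Torus bound from K1 + K2.**  On the torus of side `M`, if the coupling-field chessboard inequality (K1) holds for
the two-valued field `κ = β` off `Z'`, `(1−t)β` on `Z'`, and the coupling-reduction cost (K2) bounds
`log Z_M((1−t)β) − log Z_M(β) ≤ C M^d`, then `⟨exp(tβ ∑_{q∈Z'} φ_q)⟩_{M,β} ≤ exp(C #Z')`. [folklore] -/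
theorem wilsonExpectation_expObs_le_of_chessboard (hρ : Continuous ρ) {β t C : ℝ}
    (Z' : Finset (Plaquette d M))
    (hK1 : (∫⁻ U, ENNReal.ofReal (Real.exp (-∑ p, (β - if p ∈ Z' then t * β else 0) *
        ((N : ℝ) - (ρ (plaquetteHolonomy U p.1 p.2.1.1 p.2.1.2)).trace.re)))
        ∂(Measure.pi fun _ : Edge d M => haarProbability G)).toReal *
      (∫⁻ U, ENNReal.ofReal (Real.exp (-∑ p : Plaquette d M, β *
        ((N : ℝ) - (ρ (plaquetteHolonomy U p.1 p.2.1.1 p.2.1.2)).trace.re)))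
        ∂(Measure.pi fun _ : Edge d M => haarProbability G)).toReal ^ ((Z'.card : ℝ) / (M : ℝ) ^ d) ≤
      (∫⁻ U, ENNReal.ofReal (Real.exp (-∑ p : Plaquette d M, β *
        ((N : ℝ) - (ρ (plaquetteHolonomy U p.1 p.2.1.1 p.2.1.2)).trace.re)))
        ∂(Measure.pi fun _ : Edge d M => haarProbability G)).toReal *
      (∫⁻ U, ENNReal.ofReal (Real.exp (-∑ p : Plaquette d M, (1 - t) * β *
        ((N : ℝ) - (ρ (plaquetteHolonomy U p.1 p.2.1.1 p.2.1.2)).trace.re)))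
        ∂(Measure.pi fun _ : Edge d M => haarProbability G)).toReal ^ ((Z'.card : ℝ) / (M : ℝ) ^ d))
    (hK2 : torusLogPartition d ρ ((1 - t) * β) M - torusLogPartition d ρ β M ≤ C * (M : ℝ) ^ d) :
    wilsonExpectation ρ β (SoloBlind.expObs (G := G) ρ (t * β) Z') ≤ Real.exp (C * (Z'.card : ℝ)) := by
  -- read K1 in terms of real integrals
  simp only [toReal_lintegral_expCouplingField ρ hρ, integral_expCouplingField_const ρ hρ] at hK1
  set a : ℝ := (Z'.card : ℝ) / (M : ℝ) ^ d with ha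
  set Iκ : ℝ := ∫ U, Real.exp (-∑ p : Plaquette d M, (β - if p ∈ Z' then t * β else 0) *
        ((N : ℝ) - (ρ (plaquetteHolonomy U p.1 p.2.1.1 p.2.1.2)).trace.re))
        ∂(Measure.pi fun _ : Edge d M => haarProbability G) with hIκ
  have hZβ : 0 < Real.exp (torusLogPartition d ρ β M) := Real.exp_pos _
  have hZm : 0 < Real.exp (torusLogPartition d ρ ((1 - t) * β) M) := Real.exp_pos _
  have ha0 : 0 ≤ a := by positivity
  -- the expectation as a ratio
  have hE : wilsonExpectation ρ β (SoloBlind.expObs (G := G) ρ (t * β) Z') =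
      Iκ / Real.exp (torusLogPartition d ρ β M) := by
    rw [wilsonExpectation_eq_integral_div ρ hρ β, ← integral_expCouplingField_const ρ hρ β, hIκ]
    simp_rw [expObs_mul_weight_eq ρ β t Z', expCouplingField_const]
  rw [hE, div_le_iff₀ hZβ]
  -- K1 ⇒ `Iκ ≤ Z(β) · (Z((1-t)β)/Z(β))^a`
  have hpow : 0 < Real.exp (torusLogPartition d ρ β M) ^ a := Real.rpow_pos_of_pos hZβ a
  have h1 : Iκ ≤ Real.exp (torusLogPartition d ρ β M) *
      (Real.exp (torusLogPartition d ρ ((1 - t) * β) M) ^ a / Real.exp (torusLogPartition d ρ β M) ^ a) := by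
    rw [mul_div_assoc', le_div_iff₀ hpow]
    exact hK1
  refine h1.trans ?_
  rw [mul_comm]
  refine mul_le_mul_of_nonneg_right ?_ hZβ.le
  rw [← Real.div_rpow hZm.le hZβ.le, ← Real.exp_sub, ← Real.exp_mul]
  refine Real.exp_le_exp.2 ?_
  have hM : (0 : ℝ) < (M : ℝ) ^ d := by
    have : (0 : ℝ) < (M : ℝ) := by exact_mod_cast Nat.pos_of_ne_zero (NeZero.ne M)
    positivity
  calc (torusLogPartition d ρ ((1 - t) * β) M - torusLogPartition d ρ β M) * a
      ≤ C * (M : ℝ) ^ d * a := mul_le_mul_of_nonneg_right hK2 ha0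
    _ = C * (Z'.card : ℝ) := by rw [ha]; field_simp

end Torus

/-! ### Infinite volume: the exponential observable of a finite plaquette set of `ℤ⁴` -/

section Zd

variable {N : ℕ}
variable {G : Type*} [Group G] [TopologicalSpace G] [IsTopologicalGroup G] [CompactSpace G]
  [MeasurableSpace G] [BorelSpace G]
variable (ρ : G →* Matrix (Fin N) (Fin N) ℂ)

omit [CompactSpace G] [MeasurableSpace G] [BorelSpace G] in
/-- `U ↦ exp(c ∑_{p∈Z} (N − Re tr ρ(U_p)))` (`c ≥ 0`, `|Re tr ρ| ≤ N`) is a bounded continuous cylinder observable of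
`ℤ⁴`, supported on the edges of the plaquettes of `Z`. [folklore] -/
theorem expSum_cylinder (hρ : Continuous ρ) (hρN : ∀ g, |(ρ g).trace.re| ≤ N) {c : ℝ} (hc : 0 ≤ c)
    (Z : Finset (ZdPlaquette 4)) :
    IsCylinder (fun U : LGConfig 4 G =>
        Real.exp (c * ∑ p ∈ Z, ((N : ℝ) - plaquetteObs ρ p.1 p.2.1.1 p.2.1.2 U))) (Z.biUnion plaquetteEdges) ∧
      Continuous (fun U : LGConfig 4 G =>
        Real.exp (c * ∑ p ∈ Z, ((N : ℝ) - plaquetteObs ρ p.1 p.2.1.1 p.2.1.2 U))) ∧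
      (∃ B, ∀ U : LGConfig 4 G,
        |Real.exp (c * ∑ p ∈ Z, ((N : ℝ) - plaquetteObs ρ p.1 p.2.1.1 p.2.1.2 U))| ≤ B) := by
  refine ⟨?_, ?_, ?_⟩
  · intro U V h
    have hp : ∀ p ∈ Z, plaquetteObs ρ p.1 p.2.1.1 p.2.1.2 U = plaquetteObs ρ p.1 p.2.1.1 p.2.1.2 V :=
      fun p hp => isCylinder_plaquetteObs ρ p fun e he =>
        h e (Finset.mem_coe.2 (Finset.mem_biUnion.2 ⟨p, hp, Finset.mem_coe.1 he⟩))
    simp only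
    rw [Finset.sum_congr rfl fun p hp' => by rw [hp p hp']]
  · exact Real.continuous_exp.comp (continuous_const.mul (continuous_finsetSum Z fun p _ =>
      continuous_const.sub (continuous_plaquetteObs ρ hρ _ _ _)))
  · refine ⟨Real.exp (c * ∑ _p ∈ Z, (2 * N : ℝ)), fun U => ?_⟩
    rw [abs_of_nonneg (Real.exp_pos _).le]
    refine Real.exp_le_exp.2 (mul_le_mul_of_nonneg_left (Finset.sum_le_sum fun p _ => ?_) hc)
    unfold plaquetteObs
    linarith [(abs_le.1 (hρN (plaquetteHolonomyZd U p.1 p.2.1.1 p.2.1.2))).1]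

omit [TopologicalSpace G] [IsTopologicalGroup G] [CompactSpace G] [MeasurableSpace G] [BorelSpace G] in
/-- Read on `M`-periodic configurations, `exp(c ∑_{p∈Z} (N − Re tr ρ(U_p)))` is the torus observable
`exp(c ∑_{q∈π(Z)} φ_q)` once the projection `π` of `ℤ⁴` plaquettes to the torus is injective on `Z`. [folklore] -/
theorem toTorusObservable_expSum (c : ℝ) (Z : Finset (ZdPlaquette 4)) (M : ℕ)
    (hinj : Set.InjOn (fun p : ZdPlaquette 4 =>
      ((Literature.Probability.LatticeModels.Torus.proj M p.1, p.2) : Plaquette 4 M)) ↑Z) :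
    toTorusObservable M (fun U : LGConfig 4 G =>
        Real.exp (c * ∑ p ∈ Z, ((N : ℝ) - plaquetteObs ρ p.1 p.2.1.1 p.2.1.2 U))) =
      SoloBlind.expObs ρ c (Z.image fun p : ZdPlaquette 4 =>
        ((Literature.Probability.LatticeModels.Torus.proj M p.1, p.2) : Plaquette 4 M)) := by
  classical
  funext U
  rw [toTorusObservable_apply, SoloBlind.expObs, Finset.sum_image hinj]
  simp only [plaquetteObs, FreeEnergy.plaquetteHolonomyZd_torusLift, SoloBlind.plaquetteCost]

omit [Group G] [TopologicalSpace G] [IsTopologicalGroup G] [CompactSpace G] [MeasurableSpace G] [BorelSpace G] in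
/-- A finite set of `ℤ⁴` plaquettes projects injectively into all large tori. [folklore] -/
theorem eventually_injOn_projPlaquette (Z : Finset (ZdPlaquette 4)) :
    ∀ᶠ L : ℕ in atTop, Set.InjOn (fun p : ZdPlaquette 4 =>
      ((Literature.Probability.LatticeModels.Torus.proj (L + 1) p.1, p.2) : Plaquette 4 (L + 1))) ↑Z := by
  filter_upwards [eventually_injOn_torusEdge (d := 4) (Z.image fun p => (p.1, (0 : Fin 4)))] with L hL
  intro p hp q hq hpq
  simp only [Prod.mk.injEq] at hpq
  obtain ⟨h1, h2⟩ := hpq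
  have h := hL (Finset.mem_coe.2 (Finset.mem_image_of_mem _ (Finset.mem_coe.1 hp)))
    (Finset.mem_coe.2 (Finset.mem_image_of_mem _ (Finset.mem_coe.1 hq)))
    (by simp only [torusEdge, h1])
  exact Prod.ext (Prod.mk.inj h).1 h2

end Zd

end SparsityOfChessboard

/-! ### The item -/

open SparsityOfChessboard in
/-- **`SparsityOfChessboard` holds** (item stmt-QuantumFields-20209):
`AllSidesCouplingChessboard → CouplingReductionCost → LargeFieldSparsityAllTori` — joint large-field sparsity with
Peierls rate in every torus-limit state from the all-sides coupling-field chessboard (K1) and the coupling-reduction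
cost (K2): torus identity `⟨exp(tβ∑_{Z'}φ)⟩ = Z(κ)/Z(β)`, K1 + K2 ⇒ `≤ exp(C|Z|)` for all large sides, passage to
limit states on the bounded continuous cylinder observable, Markov. -/
theorem sparsityOfChessboard_proof :
    Summit.QuantumFields.YangMills.Theses.DirichletWindow.SparsityOfChessboard := by
  intro hK1 hK2 G _ _ _ _ _ _ hG r t ht0 ht1
  classical
  haveI : SecondCountableTopology G :=
    (r.continuous.isClosedEmbedding r.injective).isEmbedding.secondCountableTopology
  obtain ⟨C, βt, hC⟩ := hK2 G hG r t ht0 ht1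
  have habs : ∀ g, |(r.ρ g).trace.re| ≤ r.N := fun g => by
    have h := Literature.RepresentationTheory.CompactGroups.CompactGroup.abs_re_trace_le_card r.ρ r.continuous g
    simpa only [Fintype.card_fin] using h
  refine ⟨max C 0, max βt 1, fun β hβ μ hμ Z η => ?_⟩
  have hβt : βt ≤ β := (le_max_left _ _).trans hβ
  have hβ1 : (1 : ℝ) ≤ β := (le_max_right _ _).trans hβ
  have htβ : 0 ≤ t * β := by nlinarith
  obtain ⟨hcyl, hcont, hbdd⟩ := expSum_cylinder r.ρ r.continuous habs htβ Z
  -- (1) the exponential moment, uniformly over limit states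
  have hInt : ∫ U, Real.exp (t * β * ∑ p ∈ Z, ((r.N : ℝ) - plaquetteObs r.ρ p.1 p.2.1.1 p.2.1.2 U)) ∂μ ≤
      Real.exp (max C 0 * (Z.card : ℝ)) := by
    refine LocalGaussianityExpMomentTangentLaw.ExpMoment.integral_le_of_mem_limitPoints r.ρ hcyl hcont hbdd
      ?_ hμ
    filter_upwards [hC β hβt, eventually_injOn_projPlaquette Z, eventually_ge_atTop 1] with L hK2L hinj hL1
    obtain ⟨n, rfl⟩ : ∃ n, L = n + 1 := ⟨L - 1, by omega⟩
    rw [toTorusObservable_expSum r.ρ (t * β) Z (n + 1 + 1) hinj]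
    set Z' : Finset (Plaquette 4 (n + 1 + 1)) := Z.image fun p : ZdPlaquette 4 =>
      ((Literature.Probability.LatticeModels.Torus.proj (n + 1 + 1) p.1, p.2) : Plaquette 4 (n + 1 + 1)) with hZ'
    have hcard : Z'.card = Z.card := Finset.card_image_of_injOn hinj
    have hK := hK1 4 G r n β ((1 - t) * β) (by nlinarith) (by nlinarith)
      (fun p => β - if p ∈ Z' then t * β else 0) Z'
      (fun p => by constructor <;> split_ifs <;> nlinarith) (fun p hp => by simp [hp])
    dsimp only at hK
    have hb := wilsonExpectation_expObs_le_of_chessboard r.ρ r.continuous Z' hK hK2L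
    refine hb.trans (Real.exp_le_exp.2 ?_)
    rw [hcard]
    exact mul_le_mul_of_nonneg_right (le_max_left _ _) (by positivity)
  refine ⟨?_, hInt⟩
  -- (2) the probability clause: Markov in `μ`
  haveI : IsProbabilityMeasure μ := by obtain ⟨L, -, hp, -⟩ := hμ; exact hp
  set F : LGConfig 4 G → ℝ := fun U =>
    Real.exp (t * β * ∑ p ∈ Z, ((r.N : ℝ) - plaquetteObs r.ρ p.1 p.2.1.1 p.2.1.2 U)) with hF
  obtain ⟨B, hB⟩ := hbdd
  have hFi : Integrable F μ := Integrable.of_bound hcont.measurable.aestronglyMeasurable B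
    (ae_of_all _ fun U => by rw [Real.norm_eq_abs]; exact hB U)
  set lam : ℝ := Real.exp (t * β * ((Z.card : ℝ) * η)) with hlam
  have hlam0 : 0 < lam := Real.exp_pos _
  have hsub : {U : LGConfig 4 G | ∀ p ∈ Z, η ≤ (r.N : ℝ) - plaquetteObs r.ρ p.1 p.2.1.1 p.2.1.2 U} ⊆
      {U | lam ≤ F U} := by
    intro U hU
    simp only [Set.mem_setOf_eq] at hU ⊢
    refine Real.exp_le_exp.2 (mul_le_mul_of_nonneg_left ?_ htβ)
    calc (Z.card : ℝ) * η = ∑ _p ∈ Z, η := by rw [Finset.sum_const, nsmul_eq_mul]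
      _ ≤ _ := Finset.sum_le_sum fun p hp => hU p hp
  have hmk := mul_meas_ge_le_integral_of_nonneg (ae_of_all μ fun U => (Real.exp_pos _).le) hFi lam
  have hreal : μ.real {U | lam ≤ F U} ≤ Real.exp (-((Z.card : ℝ) * (t * β * η - max C 0))) := by
    have h1 : μ.real {U | lam ≤ F U} ≤ (∫ U, F U ∂μ) / lam := by
      rw [le_div_iff₀ hlam0, mul_comm]
      exact hmk
    refine h1.trans ?_
    rw [div_le_iff₀ hlam0, hlam, ← Real.exp_add]
    refine hInt.trans (Real.exp_le_exp.2 (le_of_eq ?_))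
    ring
  calc μ {U | ∀ p ∈ Z, η ≤ (r.N : ℝ) - plaquetteObs r.ρ p.1 p.2.1.1 p.2.1.2 U}
      ≤ μ {U | lam ≤ F U} := measure_mono hsub
    _ = ENNReal.ofReal (μ.real {U | lam ≤ F U}) := (ofReal_measureReal (measure_ne_top _ _)).symm
    _ ≤ ENNReal.ofReal (Real.exp (-((Z.card : ℝ) * (t * β * η - max C 0)))) := ENNReal.ofReal_le_ofReal hreal

end Summit.QuantumFields.YangMills.Theorems

end
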